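import Summits.KontsevichZagierPeriods.KontsevichZagierPeriods.Theses.CompiledSubstitutions
import Summits.KontsevichZagierPeriods.KontsevichZagierPeriods.Theses.FurushoPentagon
import Summits.KontsevichZagierPeriods.KontsevichZagierPeriods.Theorems.LinRedNormalFormHoffmanSpanInKZDoublingMove
import Summits.KontsevichZagierPeriods.KontsevichZagierPeriods.Theorems.MzvKernelInKZTwoPosetsFurushoBridge
import Summits.KontsevichZagierPeriods.KontsevichZagierPeriods.Theorems.MzvKernelInKZTwoPosetsHoffmanDepthOne
import Summits.KontsevichZagierPeriods.KontsevichZagierPeriods.Theorems.MzvKernelInKZ.Negative.ScalingDivision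
import Literature.NumberTheory.Transcendental.MultipleZetaRepeatedTwosProofs

/-!
# Crux `LinRedNormalForm.HoffmanSpanInKZ` (stmt-KontsevichZagierPeriods-15044), line `Sketch`:
# the even depth-one column (registered stub `stub_evenColumnTransfer`)

Card `even-column-newton-pi-box`: GIVEN `ZetaEvenBKC` (`[(0,1)^{2k}, 1/(1-∏xᵢ²)] ~ [(0,1)^{2k},
q·∏1/(1+xᵢ²)]`), `StuffleInKZ`, `IntegerDivision` and `DoublingMove`, the word generator
`[Δ_{2m}, q·ω_{0^{2m-1}1}]` of `q·ζ(2m)` is `≡ [Δ_{2m}, q'·ω_{(2,…,2)}]` modulo `KZ.relations` (the statements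
`EvenColumn`, `EvenColumnTransfer` are restated verbatim from the crux work file
`Cruxes/HoffmanSpanInKZ/SketchIdeator2.lean`, its local `cube`/`simplex` abbreviations inlined).
Chain, with `T_n = [(0,1)ⁿ, ∏ᵢ 1/(1+xᵢ²)]` (`boxT n`) and the RATIONAL LINE `QLine T` of a representation
`T` (the subgroup of formal combinations `≡ [σ_T, a·f_T]`, `a : ℚ`): (1) cubical chart
`[ζ(n)] ≡ [(0,1)ⁿ, 1/(1-P)]`, `P = ∏xᵢ`; (2) `1/(1-P) = 1/(1-P²) + P/(1-P²)` (rule 1b), the doubling move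
`[P/(1-P²)] ≡ 2⁻ⁿ[1/(1-P)]` and `ZetaEvenBKC` put `[ζ(2k)]` on `QLine T_{2k}`; (3) `T_a × T_b ≡ T_{a+b}`
(Fubini), so lines multiply; (4) Newton's identities from the stuffles `ζ(2j+2) ∗ ζ({2}ᵏ)` (the rows
telescope) put `(n+1)[ζ({2}ⁿ⁺¹)]`, hence `[ζ({2}ⁿ⁺¹)]` (integer division), on `QLine T_{2n+2}`; (5) its
coefficient is `≠ 0` by evaluation (`ζ({2}ᵐ) = π^{2m}/(2m+1)!`), so `T_{2m}`, `[ζ(2m)]` and the given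
generator lie on the line of Kontsevich's representation of `ζ(2,…,2)`.  Sources: M. Kontsevich,
D. Zagier, *Periods* (2001), §1.2; F. Beukers, J. A. C. Kolk, E. Calabi, Nieuw Arch. Wisk. (4) 11
(1993); M. E. Hoffman, Pacific J. Math. 152 (1992), Thm 2.2 (Newton's identities for `ζ({m}ᵏ)`).
-/

noncomputable section

namespace Summit.KontsevichZagierPeriods.LinRedNormalForm.HoffmanSpanInKZ

open Set MeasureTheory MvPolynomial Literature.NumberTheory.Transcendental
open Summit.KontsevichZagierPeriods.KontsevichZagierPeriods Summit.KontsevichZagierPeriods.MzvKernelInKZ.Negative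
  Summit.KontsevichZagierPeriods.MzvKernelInKZ.TwoPosets
open Summit.KontsevichZagierPeriods.MzvKernelInKZ.TwoPosets.HoffmanDepthOne (cubicalFun_top
  isSemialgebraicFunOn_split₂ integrableOn_split₂ isAdmissible_top zIdx_eq)

/-- The depth-one letter pattern `0^{w-1} 1` (the word of `ζ(w)`): only the last (smallest)
simplex variable carries `dt/(1-t)`. -/
def depthOneLetters (w : ℕ) : Fin w → Bool := fun i => decide ((i : ℕ) + 1 = w)

/-- **The even column of `HoffmanSpanInKZ`** (all weights): the word generator of `q·ζ(2m)` is
congruent modulo `KZ.relations` to ONE Hoffman generator `q'·ζ(2,…,2)` (`m` twos). -/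
def EvenColumn : Prop :=
  ∀ (m : ℕ), 1 ≤ m → ∀ (q : ℚ) (s : KZ.IntegralRep (2 * m)),
    s.domain = {t | (∀ i, 0 < t i) ∧ (∀ i, t i < 1) ∧ StrictAnti t} →
    EqOn s.integrand
      (fun t => (q : ℝ) * ∏ i, if depthOneLetters (2 * m) i then 1 / (1 - t i) else 1 / t i) s.domain →
    ∃ (q' : ℚ) (s' : KZ.IntegralRep (MZV.weight (List.replicate m 2))),
      s'.domain = {t | (∀ i, 0 < t i) ∧ (∀ i, t i < 1) ∧ StrictAnti t} ∧
      EqOn s'.integrand (fun t => (q' : ℝ) * KZ.mzvIntegrand (List.replicate m 2) t) s'.domain ∧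
      KZ.of s - KZ.of s' ∈ KZ.relations

/-- **Transfer of card A**: the even column follows from route CompiledSubstitutions' crux `ZetaEvenBKC`,
the landed `StuffleInKZ` (Newton's identities are ℤ-combinations of stuffles), `IntegerDivision`
(division by `n+1`) and `DoublingMove`. -/
def EvenColumnTransfer : Prop :=
  Theses.CompiledSubstitutions.ZetaEvenBKC → Theses.FurushoPentagon.StuffleInKZ →
    Theses.FurushoPentagon.IntegerDivision → DoublingMove → EvenColumn

variable {n k l : ℕ}

/-- `qmul a r = [σ, a·f]`, the rational rescaling of `r = [σ, f]`. -/
abbrev qmul (a : ℚ) (r : KZ.IntegralRep n) : KZ.IntegralRep n := r.constMul (a : ℝ) (isAlgebraic_ratCast a)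

/-- `[σ,(a+b)f] − [σ,af] − [σ,bf]` is ONE integrand-additivity move. -/
theorem of_qmul_add (a b : ℚ) (r : KZ.IntegralRep n) :
    KZ.of (qmul (a + b) r) - KZ.of (qmul a r) - KZ.of (qmul b r) ∈ KZ.relations :=
  KZ.integrandAddRel_subset_relations ⟨n, qmul (a + b) r, qmul a r, qmul b r, rfl, rfl,
    fun x _ => by simp [add_mul], rfl⟩

/-- `[σ, 1·f] ≡ [σ, f]`. -/
theorem of_qmul_one_sub_mem (r : KZ.IntegralRep n) : KZ.of (qmul 1 r) - KZ.of r ∈ KZ.relations :=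
  of_sub_of_mem_relations_of_eqOn rfl fun x _ => by simp

/-- `scale q [σ, a f] ≡ [σ, (q a) f]`. -/
theorem scale_of_qmul_sub_mem (q a : ℚ) (r : KZ.IntegralRep n) :
    KZ.scale (q : ℝ) (isAlgebraic_ratCast q) (KZ.of (qmul a r)) - KZ.of (qmul (q * a) r) ∈ KZ.relations := by
  rw [KZ.scale_of]
  exact of_sub_of_mem_relations_of_eqOn rfl fun x _ => by simp [mul_assoc]

/-- **The rational line of `T` modulo moves**: all formal combinations `≡ [σ_T, a·f_T]`, `a : ℚ`. -/
def QLine (T : KZ.IntegralRep n) : AddSubgroup KZ.FormalRep where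
  carrier := {c | ∃ a : ℚ, c - KZ.of (qmul a T) ∈ KZ.relations}
  zero_mem' := ⟨0, by
    simpa using KZ.relations.neg_mem (of_mem_relations_of_eqOn_zero (qmul 0 T) fun x _ => by simp)⟩
  add_mem' := by
    rintro c d ⟨a, ha⟩ ⟨b, hb⟩
    exact ⟨a + b, by convert sub_mem (add_mem ha hb) (of_qmul_add a b T) using 1; abel⟩
  neg_mem' := by
    rintro c ⟨a, ha⟩
    have h0 := of_qmul_add a (-a) T
    rw [add_neg_cancel] at h0
    refine ⟨-a, ?_⟩
    convert sub_mem (add_mem (neg_mem ha) h0) (of_mem_relations_of_eqOn_zero (qmul 0 T) fun x _ => by simp)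
      using 1
    abel

/-- Congruent combinations lie on the same lines. -/
theorem mem_QLine_of_sub_mem {T : KZ.IntegralRep n} {c d : KZ.FormalRep} (h : c - d ∈ KZ.relations)
    (hd : d ∈ QLine T) : c ∈ QLine T := by
  obtain ⟨a, ha⟩ := hd
  exact ⟨a, by simpa using add_mem h ha⟩

/-- `[σ_T, a f_T]` lies on the line of `T`. -/
theorem of_qmul_mem_QLine (a : ℚ) (T : KZ.IntegralRep n) : KZ.of (qmul a T) ∈ QLine T :=
  ⟨a, by simp [KZ.relations.zero_mem]⟩

/-- Lines are stable under rational rescaling. -/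
theorem scale_mem_QLine {T : KZ.IntegralRep n} (q : ℚ) {c : KZ.FormalRep} (hc : c ∈ QLine T) :
    KZ.scale (q : ℝ) (isAlgebraic_ratCast q) c ∈ QLine T := by
  obtain ⟨a, ha⟩ := hc
  have h1 := KZ.scale_mem_relations (q : ℝ) (isAlgebraic_ratCast q) ha; rw [map_sub] at h1
  exact ⟨q * a, by simpa using add_mem h1 (scale_of_qmul_sub_mem q a T)⟩

/-- A non-zero rational multiple of `[r]` on a line puts `[r]` on the line. -/
theorem of_mem_QLine_of_qmul {T : KZ.IntegralRep n} {r : KZ.IntegralRep k} {a : ℚ} (ha : a ≠ 0)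
    (h : KZ.of (qmul a r) ∈ QLine T) : KZ.of r ∈ QLine T := by
  have h2 := scale_of_qmul_sub_mem a⁻¹ a r; rw [inv_mul_cancel₀ ha] at h2
  have h3 : KZ.scale _ (isAlgebraic_ratCast a⁻¹) (KZ.of (qmul a r)) - KZ.of r ∈ KZ.relations := by
    simpa using add_mem h2 (of_qmul_one_sub_mem r)
  exact mem_QLine_of_sub_mem (by simpa using KZ.relations.neg_mem h3) (scale_mem_QLine a⁻¹ h)

/-- **Lines multiply**: `QLine T₁ · QLine T₂ ⊆ QLine T₃` whenever `T₁ × T₂ ≡ T₃`. -/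
theorem mul_mem_QLine {T₁ : KZ.IntegralRep n} {T₂ : KZ.IntegralRep k} {T₃ : KZ.IntegralRep l}
    {c d : KZ.FormalRep} (hc : c ∈ QLine T₁) (hd : d ∈ QLine T₂)
    (hT : KZ.of (T₁.prod T₂) - KZ.of T₃ ∈ KZ.relations) : c * d ∈ QLine T₃ := by
  obtain ⟨⟨a, ha⟩, ⟨b, hb⟩⟩ := And.intro hc hd
  have h1 := KZ.mul_sub_mul_mem_relations ha hb
  rw [KZ.of_mul_of] at h1
  have h2 : KZ.of ((qmul a T₁).prod (qmul b T₂)) - KZ.of (qmul (a * b) (T₁.prod T₂)) ∈ KZ.relations :=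
    of_sub_of_mem_relations_of_eqOn rfl fun z _ => by
      simp only [KZ.IntegralRep.prod_integrand_eq, KZ.IntegralRep.prodFun_apply,
        KZ.IntegralRep.integrand_constMul, Rat.cast_mul]
      ring
  have h3 : KZ.of (qmul (a * b) (T₁.prod T₂)) - KZ.of (qmul (a * b) T₃) ∈ KZ.relations :=
    KZ.Equivalent.constMul _ _ hT
  have := add_mem (add_mem h1 h2) h3
  rw [sub_add_sub_cancel, sub_add_sub_cancel] at this
  exact ⟨a * b, this⟩

/-- **Integer division on a line**: `k • c ∈ QLine T → c ∈ QLine T` (`0 < k`). -/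
theorem mem_QLine_of_nsmul_mem (hI : Theses.FurushoPentagon.IntegerDivision) {T : KZ.IntegralRep n}
    {c : KZ.FormalRep} {k : ℕ} (hk : 0 < k) (h : k • c ∈ QLine T) : c ∈ QLine T := by
  obtain ⟨a, ha⟩ := h
  refine ⟨a / k, hI _ k hk ?_⟩
  have hk' : (k : ℝ) ≠ 0 := by exact_mod_cast hk.ne'
  have h1 := scale_nat_sub_nsmul_mem k (KZ.of (qmul (a / k) T)); rw [KZ.scale_of] at h1
  have h2 : KZ.of ((qmul (a / k) T).constMul (k : ℝ) (isAlgebraic_natCast k)) - KZ.of (qmul a T) ∈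
      KZ.relations :=
    of_sub_of_mem_relations_of_eqOn rfl fun x _ => by
      simp only [KZ.IntegralRep.integrand_constMul, Rat.cast_div, Rat.cast_natCast]
      field_simp
  have h3 := sub_mem h2 h1; rw [sub_sub_sub_cancel_left] at h3
  have := sub_mem ha h3; rwa [sub_sub_sub_cancel_right, ← smul_sub] at this

/-- The π-box `T_n = [(0,1)ⁿ, ∏ᵢ 1/(1+xᵢ²)]` (value `(π/4)ⁿ`). -/
def boxT (n : ℕ) : KZ.IntegralRep n where
  domain := openUnitCube n
  integrand x := ∏ i, 1 / (1 + x i ^ 2)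
  isSemialgebraic_domain := isSemialgebraic_openUnitCube
  isSemialgebraicFunOn_integrand := by
    refine (isSemialgebraicFunOn_aeval_div_aeval isSemialgebraic_openUnitCube 1
      (∏ i : Fin n, (1 + X i ^ 2 : MvPolynomial (Fin n) ℚ)) fun x _ => ?_).congr fun x _ => ?_
    · rw [map_prod]
      exact Finset.prod_ne_zero_iff.mpr fun i _ => by simp; positivity
    · simp [map_prod, Finset.prod_inv_distrib]
  integrableOn := by
    refine (ContinuousOn.integrableOn_compact isCompact_closedUnitCube
      (Continuous.continuousOn ?_)).mono_set openUnitCube_subset_closedUnitCube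
    exact continuous_finsetProd _ fun i _ => continuous_const.div (by fun_prop) fun x => by positivity

/-- **Products of π-boxes are π-boxes**: `T_a × T_b ≡ T_c` for `a + b = c` (same cube and integrand). -/
theorem boxT_prod (a b c : ℕ) (h : a + b = c) :
    KZ.of ((boxT a).prod (boxT b)) - KZ.of (boxT c) ∈ KZ.relations := by
  subst h
  refine of_sub_of_mem_relations_of_eqOn ?_ fun z _ => ?_
  · ext z
    simp only [KZ.IntegralRep.prod_domain, KZ.IntegralRep.mem_prodDomain]
    exact ⟨fun hz => ⟨fun i => hz _, fun j => hz _⟩,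
      fun hz i => Fin.addCases (motive := fun i => z i ∈ Ioo (0:ℝ) 1) hz.1 hz.2 i⟩
  · rw [KZ.IntegralRep.prod_integrand_eq, KZ.IntegralRep.prodFun_apply]
    exact (Fin.prod_univ_add fun i => 1 / (1 + z i ^ 2)).symm

/-- **Steps (1)–(2)**: in dimension `N = m + 2`, if `[(0,1)ᴺ, 1/(1-∏xᵢ²)] ~ [(0,1)ᴺ, q·∏1/(1+xᵢ²)]`
(the conclusion of `ZetaEvenBKC`) then `[ζ(N)] ∈ QLine T_N`: cubical chart, split, doubling move. -/
theorem zIdx_mem_QLine_boxT (hD : DoublingMove) {N : ℕ} (m : ℕ) (hN : N = m + 2)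
    (hEN : ∃ q : ℚ, ∀ (r r' : KZ.IntegralRep N), r.domain = {x | ∀ i, x i ∈ Ioo (0:ℝ) 1} →
      EqOn r.integrand (fun x => 1 / (1 - ∏ i, x i ^ 2)) r.domain →
      r'.domain = {x | ∀ i, x i ∈ Ioo (0:ℝ) 1} →
      EqOn r'.integrand (fun x => (q : ℝ) * ∏ i, 1 / (1 + x i ^ 2)) r'.domain → KZ.Equivalent r r') :
    zIdx [N] 1 ∈ QLine (boxT N) := by
  subst hN
  obtain ⟨q, hq⟩ := hEN
  obtain ⟨T, hT⟩ : ∃ T : ℕ → (Fin (m + 2) → ℝ) → ℝ,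
      ∀ k x, T k x = ∏ j : Fin (m + 2), if (j : ℕ) < k then x j else 1 := ⟨_, fun _ _ => rfl⟩
  have hTP (x : Fin (m + 2) → ℝ) : T (m + 2) x = ∏ i, x i := by
    rw [hT]; exact Finset.prod_congr rfl fun j _ => if_pos j.2
  have hsq (x : Fin (m + 2) → ℝ) : (∏ i, x i ^ 2) = T (m + 2) x ^ 2 := by rw [hTP, Finset.prod_pow]
  have hP : ∀ x ∈ openUnitCube (m + 2), 0 < T (m + 2) x ∧ T (m + 2) x < 1 := fun x hx =>
    hTP x ▸ prod_mem_Ioo (by omega) hx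
  have hne : ∀ x ∈ openUnitCube (m + 2), (1 : ℝ) - T (m + 2) x ≠ 0 ∧ (1 : ℝ) - T (m + 2) x ^ 2 ≠ 0 :=
    fun x hx => ⟨(sub_pos.2 (hP x hx).2).ne', (sub_pos.2 (pow_lt_one₀ (hP x hx).1.le (hP x hx).2 two_ne_zero)).ne'⟩
  -- the boxes `A = [1/(1-P)]` (`P = T_N = ∏xᵢ`), `L = [1/(1-P²)]`, `D = [A - L] = [P/(1-P²)]`
  let A : KZ.IntegralRep (m + 2) := ⟨openUnitCube (m + 2), fun x => 1 / (1 - T (m + 2) x),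
    isSemialgebraic_openUnitCube, isSemialgebraicFunOn_split₂ hT, integrableOn_split₂ hT stub_cubicalChart⟩
  have hLs : IsSemialgebraicFunOn ℚ (openUnitCube (m + 2)) fun x => 1 / (1 - T (m + 2) x ^ 2) := by
    refine (isSemialgebraicFunOn_aeval_div_aeval isSemialgebraic_openUnitCube 1 (1 - (∏ j : Fin (m + 2),
      (if (j : ℕ) < m + 2 then X j else 1 : MvPolynomial (Fin (m + 2)) ℚ)) ^ 2) fun x hx => ?_).congr
      fun x _ => ?_ <;> simp only [map_sub, map_one, map_pow, HoffmanDepthOne.aeval_prod_ite hT]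
    exact (hne x hx).2
  let L : KZ.IntegralRep (m + 2) := ⟨openUnitCube (m + 2), fun x => 1 / (1 - T (m + 2) x ^ 2),
    isSemialgebraic_openUnitCube, hLs, Integrable.mono' A.integrableOn
      (KZ.aestronglyMeasurable_of_isSemialgebraicFunOn hLs isOpen_openUnitCube.measurableSet)
      ((ae_restrict_iff' isOpen_openUnitCube.measurableSet).2 (Filter.Eventually.of_forall fun x hx => by
        obtain ⟨h0, h1⟩ := hP x hx
        rw [Real.norm_eq_abs, abs_of_nonneg (div_nonneg zero_le_one (sub_nonneg.2 (pow_le_one₀ h0.le h1.le)))]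
        exact one_div_le_one_div_of_le (sub_pos.2 h1) (by nlinarith)))⟩
  let D : KZ.IntegralRep (m + 2) := ⟨openUnitCube (m + 2), fun x => A.integrand x - L.integrand x,
    isSemialgebraic_openUnitCube, IsSemialgebraicFunOn.sub_holds A.isSemialgebraicFunOn_integrand
      L.isSemialgebraicFunOn_integrand, A.integrableOn.sub L.integrableOn⟩
  -- (1) cubical chart; (2) the split (rule 1b), the doubling move, `ZetaEvenBKC`
  have hε : Adm (bword (m + 2) [m + 2]) := HoffmanDepthOne.adm_bword (isAdmissible_top m) rfl
  have h1 : KZ.of (wordRep _ 1 hε) - KZ.of A ∈ KZ.relations :=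
    (stub_cubicalChart (m + 2) _ hε 1).2 A rfl fun x hx => (cubicalFun_top hT hx).symm
  have h2 : KZ.of A - KZ.of L - KZ.of D ∈ KZ.relations :=
    KZ.integrandAddRel_subset_relations ⟨m + 2, A, L, D, rfl, rfl, fun x _ => by simp [D], rfl⟩
  have h3 : KZ.of D - KZ.of (qmul (1 / 2 ^ (m + 2)) A) ∈ KZ.relations := by
    refine hD (m + 2) (by omega) D _ rfl (fun x hx => ?_) rfl fun x _ => ?_
    · obtain ⟨n1, n2⟩ := hne x hx
      show 1 / (1 - T (m + 2) x) - 1 / (1 - T (m + 2) x ^ 2) = (∏ i, x i) / (1 - (∏ i, x i) ^ 2)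
      rw [← hTP]
      field_simp
      ring
    · show (((1 / 2 ^ (m + 2) : ℚ) : ℝ)) * (1 / (1 - T (m + 2) x)) = 1 / 2 ^ (m + 2) / (1 - ∏ i, x i)
      rw [hTP]
      push_cast
      ring
  have h4 : KZ.of L - KZ.of (qmul q (boxT (m + 2))) ∈ KZ.relations :=
    hq L _ rfl (fun x _ => by show 1 / (1 - T (m + 2) x ^ 2) = 1 / (1 - ∏ i, x i ^ 2); rw [hsq]) rfl fun _ _ => rfl
  -- assembly: `(1 - 2⁻ᴺ)·[A] ≡ [L]` lies on the line of `T_N`, hence `[A]`, hence `[ζ(N)]`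
  have h5 : KZ.of (qmul (1 - 1 / 2 ^ (m + 2)) A) ∈ QLine (boxT (m + 2)) := by
    refine mem_QLine_of_sub_mem ?_ (mem_QLine_of_sub_mem h4 (of_qmul_mem_QLine q _))
    have ha := of_qmul_add (1 - 1 / 2 ^ (m + 2)) (1 / 2 ^ (m + 2)) A
    rw [sub_add_cancel] at ha
    convert add_mem (add_mem (add_mem (neg_mem ha) (of_qmul_one_sub_mem A)) h2) h3 using 1
    abel
  have hc : (1 : ℚ) - 1 / 2 ^ (m + 2) ≠ 0 := by
    rw [sub_ne_zero, ne_comm, ne_eq, div_eq_one_iff_eq (by positivity)]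
    exact (one_lt_pow₀ (by norm_num : (1 : ℚ) < 2) (by omega : m + 2 ≠ 0)).ne
  rw [zIdx_eq (N := m + 2) rfl hε 1]
  exact mem_QLine_of_sub_mem h1 (of_mem_QLine_of_qmul hc h5)

/-- **The harmonic product `(c) ∗ (m, …, m)`** summed against any additive-monoid-valued `f`: the
`k + 1` insertions plus the `k` contractions (the tree's `MZV.sum_map_stuffle_singleton_replicate`, `ℝ`). -/
theorem sum_map_stuffle_singleton_replicate {M : Type*} [AddCommMonoid M] (f : List ℕ → M)
    (c m : ℕ) : ∀ k : ℕ, ((MZV.stuffle [c] (List.replicate k m)).map f).sum =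
      ∑ i ∈ Finset.range (k + 1), f (List.replicate i m ++ c :: List.replicate (k - i) m) +
        ∑ i ∈ Finset.range k, f (List.replicate i m ++ (c + m) :: List.replicate (k - (i + 1)) m)
  | 0 => by simp
  | k + 1 => by
      rw [List.replicate_succ, MZV.stuffle_cons_cons, MZV.stuffle_nil_left, MZV.stuffle_nil_left]
      simp only [List.map_append, List.map_cons, List.map_nil, List.sum_append, List.sum_cons,
        List.sum_nil, add_zero, List.map_map]
      rw [sum_map_stuffle_singleton_replicate (f ∘ List.cons m) c m k,
        Finset.sum_range_succ' (fun i => f (List.replicate i m ++ c :: List.replicate (k + 1 - i) m)),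
        Finset.sum_range_succ'
          (fun i => f (List.replicate i m ++ (c + m) :: List.replicate (k + 1 - (i + 1)) m))]
      simp only [Function.comp_apply, List.replicate_succ, List.cons_append, List.replicate_zero,
        List.nil_append, Nat.add_sub_add_right, Nat.sub_zero, Nat.add_sub_cancel, zero_add]
      abel

/-- **Steps (3)–(4)**: `[ζ({2}ⁿ)] ∈ QLine T_{2n}` for every `n`, by strong induction through Newton's
identities — row `k`, the stuffle `[ζ(2k+2)]·[ζ({2}^{n-k})]`, is (insertions of `2k+2`) + (insertions of
`2k+4`) and lies on `QLine T_{2n+2}` (lines multiply); the rows telescope to `(n+1)·[ζ({2}ⁿ⁺¹)]`. -/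
theorem zIdx_replicate_mem_QLine (hE : Theses.CompiledSubstitutions.ZetaEvenBKC)
    (hS : Theses.FurushoPentagon.StuffleInKZ) (hI : Theses.FurushoPentagon.IntegerDivision)
    (hD : DoublingMove) : ∀ n : ℕ, zIdx (List.replicate n 2) 1 ∈ QLine (boxT (2 * n)) := by
  have hZ : ∀ k, 1 ≤ k → zIdx [2 * k] 1 ∈ QLine (boxT (2 * k)) := fun k hk =>
    zIdx_mem_QLine_boxT hD (2 * k - 2) (by omega) (hE k hk)
  have hSt := hS (fun u => zIdx u 1) (fun u hu => zIdx_one_eq_of_mzvRep u hu)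
  intro n
  induction n using Nat.strong_induction_on with
  | _ n ih =>
  rcases n with _ | n
  · -- `[ζ(∅)] = [pt, 1] ≡ T₀`
    show zIdx [] 1 ∈ QLine (boxT 0)
    rw [zIdx_of_adm MZV.isAdmissible_nil]
    refine mem_QLine_of_sub_mem (of_sub_of_mem_relations_of_eqOn ?_ fun t _ => ?_) (of_qmul_mem_QLine 1 _)
    · show openUnitCube 0 = simplex 0
      rw [simplex_zero]
      exact eq_univ_of_forall fun t i => i.elim0
    · haveI : IsEmpty (Fin (MZV.weight ([] : List ℕ))) := Fin.isEmpty'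
      show wordFun _ 1 t = ((1 : ℚ) : ℝ) * ∏ i : Fin 0, 1 / (1 + t i ^ 2)
      simp [wordFun]
  · -- Newton for `n + 1`: insertions `A`, contractions `B`, rows `R`
    let A : ℕ → KZ.FormalRep := fun k => ∑ i ∈ Finset.range (n - k + 1),
      zIdx (List.replicate i 2 ++ (2 * (k + 1)) :: List.replicate (n - k - i) 2) 1
    let B : ℕ → KZ.FormalRep := fun k => ∑ i ∈ Finset.range (n - k),
      zIdx (List.replicate i 2 ++ (2 * (k + 1) + 2) :: List.replicate (n - k - (i + 1)) 2) 1
    let R : ℕ → KZ.FormalRep := fun k => zIdx [2 * (k + 1)] 1 * zIdx (List.replicate (n - k) 2) 1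
    have hrow : ∀ k, R k - (A k + B k) ∈ KZ.relations := fun k => by
      have h := hSt [2 * (k + 1)] (List.replicate (n - k) 2) (isAdmissible_top (2 * k))
        (MZV.isAdmissible_replicate_two _)
      rwa [sum_map_stuffle_singleton_replicate] at h
    have hB : ∀ k, k < n → B k = A (k + 1) := fun k hk => by
      simp only [A, B]
      rw [show n - (k + 1) + 1 = n - k by omega]
      refine Finset.sum_congr rfl fun i _ => ?_
      rw [show 2 * (k + 1) + 2 = 2 * (k + 1 + 1) by ring, show n - k - (i + 1) = n - (k + 1) - i by omega]
    have hR : ∀ k, k ≤ n → R k ∈ QLine (boxT (2 * (n + 1))) := fun k hk =>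
      mul_mem_QLine (hZ (k + 1) (by omega)) (ih (n - k) (by omega)) (boxT_prod _ _ _ (by omega))
    -- descend the rows: `A (n - j)` lies on the line for every `j ≤ n`
    have hAd : ∀ j, j ≤ n → A (n - j) ∈ QLine (boxT (2 * (n + 1))) := by
      intro j
      induction j with
      | zero =>
        intro _
        have h := hrow n
        rw [show B n = 0 by simp [B], add_zero] at h
        exact mem_QLine_of_sub_mem (by simpa using KZ.relations.neg_mem h) (hR n le_rfl)
      | succ j ihj =>
        intro hj
        have h := hrow (n - (j + 1))
        rw [hB _ (by omega), show n - (j + 1) + 1 = n - j by omega] at h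
        refine mem_QLine_of_sub_mem ?_ (sub_mem (hR (n - (j + 1)) (by omega)) (ihj (by omega)))
        convert KZ.relations.neg_mem h using 1
        abel
    have hA0 : A 0 = (n + 1) • zIdx (List.replicate (n + 1) 2) 1 := by
      simp only [A, Nat.sub_zero]
      rw [Finset.sum_congr rfl fun i hi => by
        rw [show 2 * (0 + 1) = 2 from rfl, ← List.replicate_succ, List.replicate_append_replicate,
          show i + (n - i + 1) = n + 1 by have := Finset.mem_range.mp hi; omega],
        Finset.sum_const, Finset.card_range]
    have hfin := hAd n le_rfl
    rw [Nat.sub_self, hA0] at hfin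
    exact mem_QLine_of_nsmul_mem hI (Nat.succ_pos n) hfin

/-- The depth-one letters `0^{n-1}1` are the word of the index `(n)`, `n ≥ 1`. -/
theorem depthOneLetters_eq_bword {n : ℕ} (hn : 1 ≤ n) : depthOneLetters n = bword n [n] := by
  obtain ⟨n, rfl⟩ : ∃ k, n = k + 1 := ⟨n - 1, by omega⟩
  funext i
  simp only [bword, wordOf, depthOneLetters]
  rw [FurushoPentagon.HoffmanRelationInKZ.getD_binaryWord_succ_cons]
  split_ifs with h1 h2
  · simp; omega
  · simp; omega
  · simp [MZV.binaryWord]; omega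

/-- **Registered stub `stub_evenColumnTransfer`** (card `even-column-newton-pi-box`): the even depth-one
column of `HoffmanSpanInKZ` follows from `ZetaEvenBKC`, `StuffleInKZ`, `IntegerDivision`, `DoublingMove`. -/
theorem stub_evenColumnTransfer : EvenColumnTransfer := by
  intro hE hS hI hD m hm q s hd hi
  have hadm : MZV.IsAdmissible (List.replicate m 2) := MZV.isAdmissible_replicate_two m
  -- Kontsevich's representation of `ζ(2,…,2)` and its line
  let H : KZ.IntegralRep (MZV.weight (List.replicate m 2)) := KZ.mzvRep (List.replicate m 2) hadm
    (KZ.mzvIntegrand_isSemialgebraicFunOn_holds _) (KZ.mzvIntegrand_integrableOn_holds _ hadm)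
  have hH : zIdx (List.replicate m 2) 1 = KZ.of H := zIdx_one_eq_of_mzvRep _ hadm
  obtain ⟨b, hb⟩ := zIdx_replicate_mem_QLine hE hS hI hD m
  -- (5) the coefficient is non-zero by evaluation
  have hb0 : b ≠ 0 := by
    rintro rfl
    have hev := KZ.relations_le_ker_eval_holds hb
    rw [AddMonoidHom.mem_ker, map_sub, hH, KZ.eval_of, KZ.eval_of, KZ.mzvRep_value_holds,
      multipleZeta_replicate_two, KZ.IntegralRep.value_constMul, Rat.cast_zero, zero_mul, sub_zero] at hev
    exact absurd hev (by positivity)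
  -- hence `T_{2m}`, and with it `[ζ(2m)]`, lies on the line of `H`
  obtain ⟨a, ha⟩ : KZ.of (boxT (2 * m)) ∈ QLine H := by
    refine of_mem_QLine_of_qmul hb0 (mem_QLine_of_sub_mem (by simpa using KZ.relations.neg_mem hb) ?_)
    rw [hH]
    exact mem_QLine_of_sub_mem (by simpa using KZ.relations.neg_mem (of_qmul_one_sub_mem H))
      (of_qmul_mem_QLine 1 H)
  obtain ⟨b', hb'⟩ := zIdx_mem_QLine_boxT hD (2 * m - 2) (by omega) (hE m hm)
  have hZ : zIdx [2 * m] 1 ∈ QLine H := by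
    have h1 := scale_mem_QLine b' (mem_QLine_of_sub_mem ha (of_qmul_mem_QLine a H))
    rw [KZ.scale_of] at h1
    exact mem_QLine_of_sub_mem hb' h1
  -- the given generator is `q·[ζ(2m)]`
  simp only [depthOneLetters_eq_bword (show 1 ≤ 2 * m by omega)] at hi
  have hε : Adm (bword (2 * m) [2 * m]) :=
    HoffmanDepthOne.adm_bword ⟨fun i hi => by simp at hi; omega, fun _ => by show 2 ≤ 2 * m; omega⟩ rfl
  have hs1 : KZ.of s - KZ.of (wordRep _ q hε) ∈ KZ.relations := of_sub_of_wordRep_mem_relations hε s hd hi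
  have hs2 : KZ.of (wordRep _ q hε) - KZ.of (qmul q (wordRep _ 1 hε)) ∈ KZ.relations :=
    of_sub_of_mem_relations_of_eqOn rfl fun t _ => by simp [wordRep_integrand, wordFun]
  have hs3 : KZ.of (qmul q (wordRep _ 1 hε)) ∈ QLine H := by
    have := scale_mem_QLine q hZ
    rwa [zIdx_eq (N := 2 * m) rfl hε 1, KZ.scale_of] at this
  obtain ⟨q', hq'⟩ := mem_QLine_of_sub_mem hs1 (mem_QLine_of_sub_mem hs2 hs3)
  exact ⟨q', qmul q' H, rfl, fun _ _ => rfl, hq'⟩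

end Summit.KontsevichZagierPeriods.LinRedNormalForm.HoffmanSpanInKZ
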